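import Literature.NumberTheory.LFunctions.YoshidaWindowGramColumnData
import HarnessLib

/-!
# C∞ rung `R1E` (even sector) — DATA `PVN` part 1/1

Route context: Fourier–Galerkin / Schur-complement certificates of Weil positivity on a window ("format C", C∞ door `weilPositivityOn_of_cinf_pipeline`); supporting stmt-RiemannHypothesis-0098; seat rh-explicit-weil-2 (`cinfemit.py`/`emit_lean2.py`, HOME/rh-explicit-weil-2/gen17/EMITTER-PHASE2.md). Data / bookkeeping only; standard axioms; no RH claim.
-/

set_option autoImplicit false
-- `Summit.RiemannHypothesis.RiemannHypothesis.…` is the layout-mandated namespace (summit = problem name).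
set_option linter.dupNamespace false

namespace Summit.RiemannHypothesis.RiemannHypothesis.Theorems.WeilFormatC

open Literature.NumberTheory.LFunctions

namespace CinfR1E

/-- Packed rows part 1/1 of table `PVN` (word width 355, 4 words). -/
def PVN_P : List ℕ := [
  0x7fffffffffced5c756852df61d804aa1e2d43c80426c3692fe47d058577e0ab6a9984fbf574c31663ba1e430d00000000000002969709218908bfc8b327ad2f5461a6b1b8268a3768f25566f5d6eb6cb9c282a830221999e29ffffffffffffffffdd1e99f859285f84a265dd6f9847912df39ed1db2dff1f1d62a06f9cb7055af40da30c8d400000000000000000001f3065abfc226b08251b2395ec992fcb1d4df8507786ad65fe59e190ff164748904ed,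
  0x80000006e0989a4d2ff85d2a811bc34e9b52a5492f6f1089d4e8c275d1c477e841f84f991177b654cec0be49cffffffffffa350c81b98c3a2cd162512ee6aa9494b09329811def02a34dfa698172d0fe65d6483d5dca4a02fa00000000000004e104963daa2a440f39f34f477bf1d79c499c0dc5b227e5e39d196510e626bf67acd4c76335bffffffffffffffffba3d31cbb355f3092bf39bb7345620274247bb4636773217a9130db1ddcf737efedfe372,
  0x7ffefab44fcd50c1a6dcdb2cb37b93dedd526cea82051471e1eef5665e0eb8e751510ec6a750b11950a75d3570000000dc16d135bfc9d3b2dececdcda39c6c5054647eb6f1eecdf5895a11f8e005bc0ab51a4cc213a733a199ffffffffff46a190373f4bacb4cc1a47717e866f7df00f075c309af11834104c5682c7c070ab894974e0ae41c0000000000000a5a5c769a69dd1dd37b5a9210f4128823b5c5f414544efc72ad74a37d65c9b141edb51b663f,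
  0xa6c6f3a6b6671cb9dc3257be8c837af0aaf31dccb8938921e1948b3395280ab896a5c895827cff06a96218d7afffdf5689f9aa182a4ec1d7cf023fe61f17344d67d4666d648bbab23e8d529a2b54f5d7848a2708b1a4d060f60000001b82626932b41dcf1321c735cdd66277e489812278e4a822f2fd449f5415e594b3fb1a7b45ee25fe5dbfffffffffe76ae2e8105a74c26c437bdb586f4907fa5b1e26776cc683986e96934ef4b19e8f665c39d280c73]

end CinfR1E

end Summit.RiemannHypothesis.RiemannHypothesis.Theorems.WeilFormatC
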